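import Literature.AnabelianGeometry.SemiGraphs.CoveringFullPrep

/-!
# The comparison functor `B(𝒢)_{/A} ⥤ B(𝒢_A)` is full ([SemiAnbd] Def. 2.2 (i), global clause — brick G6(b))

Mochizuki, *Semi-graphs of anabelioids*, Publ. RIMS **42** (2006) 221–322, §2 p. 23
[cite: MochizukiSemiAnbd2006, Def. 2.2(i) p.23].  Given `m : toCovering X → toCovering Y` in `B(𝒢_A)`,
the vertex component `X_v → Y_v` of its preimage is assembled from the pieces
`X_v ×_{S_v} P → Y_v ×_{S_v} P` on the coproduct decomposition `X_v = ∐_P X_v ×_{S_v} P`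
(`liftV`), similarly for edges (`liftE`); compatibility with the gluing isomorphisms `ψ_b` is checked
on the finer decomposition of `b^* X_v` along the branches of `𝔾_A` over `b`.
-/

namespace Literature.AnabelianGeometry.SemiGraphs

namespace SemiGraphOfAnabelioids

open CategoryTheory CategoryTheory.Limits CategoryTheory.PreGaloisCategory
open Literature.AnabelianGeometry.Anabelioids

universe w' w v₁ u₁ u

-- Mathlib's `Over.pullback` / `Over.star` simp lemmas (`pullback.lift_fst`, …) only fire under the
-- pre-v4.2x defeq transparency behaviour, exactly as in `Mathlib/CategoryTheory/Comma/Over/Pullback.lean`.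
set_option backward.isDefEq.respectTransparency false

namespace BObj

variable {𝒢 : SemiGraphOfAnabelioids.{v₁, u₁, u}} {A : 𝒢.BObj} {X Y : Over A}
  (m : A.toCovering.obj X ⟶ A.toCovering.obj Y)

/-! ### Assembling the vertex and edge components -/

/-- The vertex component `X_v → Y_v` assembled from the pieces `X_v ×_{S_v} P → Y_v ×_{S_v} P → Y_v` of `m`
on `X_v = ∐_P X_v ×_{S_v} P`. [cite: MochizukiSemiAnbd2006, Def. 2.2(i) p.23] -/
noncomputable def liftV (v : 𝒢.graph.Vertex) : X.left.S v ⟶ Y.left.S v :=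
  Cofan.IsColimit.desc (A.isColimit_cofan_vertices v (X.hom.fS v)).some
    (fun c => (preimV m ⟨v, c⟩).left ≫ pullback.fst _ _)

/-- `liftV` on the piece `X_v ×_{S_v} P`. [cite: MochizukiSemiAnbd2006, Def. 2.2(i) p.23] -/
@[reassoc] theorem ι_liftV (v : 𝒢.graph.Vertex) (c : Shrink.{u} (π₀Obj (A.S v))) :
    pullback.fst (X.hom.fS v) (A.vComp ⟨v, c⟩).1.arrow ≫ liftV m v =
      (preimV m ⟨v, c⟩).left ≫ pullback.fst _ _ :=
  Cofan.IsColimit.fac (A.isColimit_cofan_vertices v (X.hom.fS v)).some _ c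

/-- `liftV` is a morphism over `S_v`. [cite: MochizukiSemiAnbd2006, Def. 2.2(i) p.23] -/
@[reassoc] theorem liftV_over (v : 𝒢.graph.Vertex) : liftV m v ≫ Y.hom.fS v = X.hom.fS v := by
  refine Cofan.IsColimit.hom_ext (A.isColimit_cofan_vertices v (X.hom.fS v)).some _ _ (fun c => ?_)
  rw [cofan_mk_inj, ι_liftV_assoc]
  have h1 := pullback.condition (f := ((Over.post (𝒢.ρ v)).obj Y).hom) (g := (A.vComp ⟨v, c⟩).1.arrow)
  have h2 := pullback.condition (f := ((Over.post (𝒢.ρ v)).obj X).hom) (g := (A.vComp ⟨v, c⟩).1.arrow)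
  erw [h1, h2, (preimV m ⟨v, c⟩).w_assoc]
  rfl

/-- The edge component `X_e → Y_e` assembled from the pieces of `m` on `X_e = ∐_Q X_e ×_{T_e} Q`.
[cite: MochizukiSemiAnbd2006, Def. 2.2(i) p.23] -/
noncomputable def liftE (e : 𝒢.graph.Edge) : X.left.T e ⟶ Y.left.T e :=
  Cofan.IsColimit.desc (A.isColimit_cofan_edges e (X.hom.fT e)).some
    (fun c => (preimE m ⟨e, c⟩).left ≫ pullback.fst _ _)

/-- `liftE` on the piece `X_e ×_{T_e} Q`. [cite: MochizukiSemiAnbd2006, Def. 2.2(i) p.23] -/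
@[reassoc] theorem ι_liftE (e : 𝒢.graph.Edge) (c : Shrink.{u} (π₀Obj (A.T e))) :
    pullback.fst (X.hom.fT e) (A.eComp ⟨e, c⟩).1.arrow ≫ liftE m e =
      (preimE m ⟨e, c⟩).left ≫ pullback.fst _ _ :=
  Cofan.IsColimit.fac (A.isColimit_cofan_edges e (X.hom.fT e)).some _ c

/-- `liftE` is a morphism over `T_e`. [cite: MochizukiSemiAnbd2006, Def. 2.2(i) p.23] -/
@[reassoc] theorem liftE_over (e : 𝒢.graph.Edge) : liftE m e ≫ Y.hom.fT e = X.hom.fT e := by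
  refine Cofan.IsColimit.hom_ext (A.isColimit_cofan_edges e (X.hom.fT e)).some _ _ (fun c => ?_)
  rw [cofan_mk_inj, ι_liftE_assoc]
  have h1 := pullback.condition (f := ((Over.post (𝒢.ρE e)).obj Y).hom) (g := (A.eComp ⟨e, c⟩).1.arrow)
  have h2 := pullback.condition (f := ((Over.post (𝒢.ρE e)).obj X).hom) (g := (A.eComp ⟨e, c⟩).1.arrow)
  erw [h1, h2, (preimE m ⟨e, c⟩).w_assoc]
  rfl

/-! ### The finer decomposition of `b^* X_v` along the branches of `𝔾_A` over `b` -/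

/-- A decorated branch `(b, c')` abuts to `(v, σ_b c')`. [cite: MochizukiSemiAnbd2006, Def. 2.2(i) p.23] -/
theorem total_abuts_mk (A : 𝒢.BObj) {b : 𝒢.graph.Branch} {v : 𝒢.graph.Vertex} (h : 𝒢.graph.abuts b = some v)
    (c' : Shrink.{u} (π₀Obj (A.T (𝒢.graph.edgeOf b)))) :
    A.fibreData.total.abuts ⟨b, c'⟩ = some ⟨v, A.fibreData.σ b v h c'⟩ := by
  change (𝒢.graph.abuts b).pbind _ = _
  simp only [h, Option.pbind_some]

/-- The piece `b^* U ×_{b^* P} Q` of the gluing functor along `(b, Q)` at `(v, P)` IS the summand of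
`b^* U` over the component `Q` of `T_e` (cancel the monomorphism `b^* P ↪ T_e`).
[cite: MochizukiSemiAnbd2006, Def. 2.2(i) p.23] -/
theorem isPullback_gluing_summand (A : 𝒢.BObj) {b : 𝒢.graph.Branch} {v : 𝒢.graph.Vertex}
    (h : 𝒢.graph.abuts b = some v) (c : Shrink.{u} (π₀Obj (A.S v)))
    (c' : Shrink.{u} (π₀Obj (A.T (𝒢.graph.edgeOf b)))) (h' : A.fibreData.total.abuts ⟨b, c'⟩ = some ⟨v, c⟩)
    (U : Over ((A.vComp ⟨v, c⟩).1 : 𝒢.V (A.fibreData.proj.vertexMap ⟨v, c⟩))) :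
    IsPullback
      (pullback.fst _ _ : ((A.gluingAt ⟨b, c'⟩ ⟨v, c⟩ h').obj U).left ⟶ _)
      (pullback.snd _ _ : ((A.gluingAt ⟨b, c'⟩ ⟨v, c⟩ h').obj U).left ⟶ _)
      (((Over.post (𝒢.pull b v h).pullback).obj U).hom ≫
        (𝒢.pull b v h).pullback.map (A.vComp ⟨v, c⟩).1.arrow ≫ (A.ψ b v h).hom)
      (A.eComp ⟨𝒢.graph.edgeOf b, c'⟩).1.arrow := by
  haveI := A.mono_map_arrow_comp_ψ b v h (A.vComp ⟨v, c⟩).1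
  have t := IsPullback.of_isLimit' ⟨by rw [← Category.assoc, pullback.condition, Category.assoc]⟩
    (pullbackIsPullbackOfCompMono (((Over.post (𝒢.pull b v h).pullback).obj U).hom)
      (A.inclOfLE h (A.vComp ⟨v, c⟩).1 (A.brComp ⟨b, c'⟩).1 (brComp_le_branchImage h'))
      ((𝒢.pull b v h).pullback.map (A.vComp ⟨v, c⟩).1.arrow ≫ (A.ψ b v h).hom))
  rw [inclOfLE_comp] at t
  exact t

/-- For a component `Q` of `T_e` NOT under `P` along `b`, the summand of `b^* U` (`U → P`) over `Q` is
EMPTY: it maps to `b^* P ×_{T_e} b^* P' = b^*(P ×_{S_v} P') = b^* ∅` (`P' ≠ P` the component under `Q`;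
disjointness of components, exactness of `b^*`, strictness of initial objects).
[cite: MochizukiSemiAnbd2006, Def. 2.2(i) p.23] -/
theorem isInitial_summand (A : 𝒢.BObj) {b : 𝒢.graph.Branch} {v : 𝒢.graph.Vertex}
    (h : 𝒢.graph.abuts b = some v) (c : Shrink.{u} (π₀Obj (A.S v)))
    (c' : Shrink.{u} (π₀Obj (A.T (𝒢.graph.edgeOf b)))) (hne : A.fibreData.σ b v h c' ≠ c)
    (U : Over ((A.vComp ⟨v, c⟩).1 : 𝒢.V (A.fibreData.proj.vertexMap ⟨v, c⟩))) :
    Nonempty (IsInitial (pullback (((Over.post (𝒢.pull b v h).pullback).obj U).hom ≫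
        (𝒢.pull b v h).pullback.map (A.vComp ⟨v, c⟩).1.arrow ≫ (A.ψ b v h).hom)
      (A.eComp ⟨𝒢.graph.edgeOf b, c'⟩).1.arrow)) := by
  haveI : PreservesFiniteLimits (𝒢.pull b v h).pullback := (𝒢.pull b v h).property.1
  haveI : PreservesFiniteColimits (𝒢.pull b v h).pullback := (𝒢.pull b v h).property.2
  haveI := finitaryExtensive_of_galoisCategory (𝒢.E (𝒢.graph.edgeOf b))
  haveI := A.mono_map_arrow_comp_ψ b v h (A.vComp ⟨v, c⟩).1
  haveI := A.mono_map_arrow_comp_ψ b v h (A.vComp ⟨v, A.fibreData.σ b v h c'⟩).1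
  have hPP' : A.vComp ⟨v, c⟩ ≠ A.vComp ⟨v, A.fibreData.σ b v h c'⟩ := fun e =>
    hne ((equivShrink (π₀Obj (A.S v))).symm.injective e).symm
  obtain ⟨hI⟩ := isInitial_pullback_components_of_ne _ _ hPP'
  have hV₀ : IsInitial (pullback ((𝒢.pull b v h).pullback.map (A.vComp ⟨v, c⟩).1.arrow)
      ((𝒢.pull b v h).pullback.map (A.vComp ⟨v, A.fibreData.σ b v h c'⟩).1.arrow)) :=
    (hI.isInitialObj (𝒢.pull b v h).pullback).ofIso (PreservesPullback.iso (𝒢.pull b v h).pullback _ _)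
  have hV : IsInitial (pullback ((𝒢.pull b v h).pullback.map (A.vComp ⟨v, c⟩).1.arrow ≫ (A.ψ b v h).hom)
      ((𝒢.pull b v h).pullback.map (A.vComp ⟨v, A.fibreData.σ b v h c'⟩).1.arrow ≫ (A.ψ b v h).hom)) :=
    hV₀.ofIso (IsPullback.of_isLimit' ⟨by rw [← Category.assoc, pullback.condition, Category.assoc]⟩
      (pullbackIsPullbackOfCompMono ((𝒢.pull b v h).pullback.map (A.vComp ⟨v, c⟩).1.arrow)
        ((𝒢.pull b v h).pullback.map (A.vComp ⟨v, A.fibreData.σ b v h c'⟩).1.arrow) (A.ψ b v h).hom)).isoPullback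
  have hle' : (A.eComp ⟨𝒢.graph.edgeOf b, c'⟩).1 ≤ A.branchImage b v h (A.vComp ⟨v, A.fibreData.σ b v h c'⟩).1 :=
    brComp_le_branchImage (A.total_abuts_mk h c')
  let k := pullback.lift
    (f := (𝒢.pull b v h).pullback.map (A.vComp ⟨v, c⟩).1.arrow ≫ (A.ψ b v h).hom)
    (g := (𝒢.pull b v h).pullback.map (A.vComp ⟨v, A.fibreData.σ b v h c'⟩).1.arrow ≫ (A.ψ b v h).hom)
    (pullback.fst (((Over.post (𝒢.pull b v h).pullback).obj U).hom ≫
        (𝒢.pull b v h).pullback.map (A.vComp ⟨v, c⟩).1.arrow ≫ (A.ψ b v h).hom)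
      (A.eComp ⟨𝒢.graph.edgeOf b, c'⟩).1.arrow ≫ ((Over.post (𝒢.pull b v h).pullback).obj U).hom)
    (pullback.snd _ _ ≫ A.inclOfLE h _ _ hle')
    (by simp only [Category.assoc, inclOfLE_comp]; exact pullback.condition)
  haveI := hV.isIso_to k
  exact ⟨hV.ofIso (asIso k).symm⟩

/-! ### Compatibility with the gluing isomorphisms `ψ_b` -/

/-- **The assembled components commute with `ψ_b`**: `b^*(liftV) ≫ ψ_b^Y = ψ_b^X ≫ liftE`, checked on the
decomposition of `b^* X_v` into the pieces `b^*(X_v ×_{S_v} P) ×_{T_e} Q` over the vertices `(v, P)` and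
edges `(e, Q)` of `𝔾_A`: the piece is empty unless `(b, Q)` abuts to `(v, P)`, and then it is the gluing
object, where `m`'s gluing compatibility (`glue_compat`) applies. [cite: MochizukiSemiAnbd2006, Def. 2.2(i) p.23] -/
theorem comm_lift (b : 𝒢.graph.Branch) (v : 𝒢.graph.Vertex) (h : 𝒢.graph.abuts b = some v) :
    (𝒢.pull b v h).pullback.map (liftV m v) ≫ (Y.left.ψ b v h).hom =
      (X.left.ψ b v h).hom ≫ liftE m (𝒢.graph.edgeOf b) := by
  haveI : PreservesFiniteLimits (𝒢.pull b v h).pullback := (𝒢.pull b v h).property.1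
  haveI : PreservesFiniteColimits (𝒢.pull b v h).pullback := (𝒢.pull b v h).property.2
  haveI : Finite (Shrink.{u} (π₀Obj (A.S v))) := Finite.of_equiv _ (equivShrink _)
  obtain ⟨hc⟩ := A.isColimit_cofan_vertices v (X.hom.fS v)
  refine Cofan.IsColimit.hom_ext (isColimitCofanMkObjOfIsColimit (𝒢.pull b v h).pullback _ _ hc) _ _
    (fun c => ?_)
  rw [cofan_mk_inj, ← Functor.map_comp_assoc, ι_liftV, Functor.map_comp_assoc]
  -- decompose `b^*(X_v ×_{S_v} P)` along the components of `T_e`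
  obtain ⟨hc'⟩ := A.isColimit_cofan_edges (𝒢.graph.edgeOf b)
    (((Over.post (𝒢.pull b v h).pullback).obj ((A.toCoveringV ⟨v, c⟩).obj X)).hom ≫
      (𝒢.pull b v h).pullback.map (A.vComp ⟨v, c⟩).1.arrow ≫ (A.ψ b v h).hom)
  refine Cofan.IsColimit.hom_ext hc' _ _ (fun c' => ?_)
  rw [cofan_mk_inj]
  by_cases hσ : A.fibreData.σ b v h c' = c
  · -- the piece is the gluing object of the branch `(b, c')` at `(v, c)`
    have h' : A.fibreData.total.abuts ⟨b, c'⟩ = some ⟨v, c⟩ := by rw [A.total_abuts_mk h c', hσ]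
    have hW := A.isPullback_gluing_summand h c c' h' ((A.toCoveringV ⟨v, c⟩).obj X)
    rw [← cancel_epi hW.isoPullback.hom, hW.isoPullback_hom_fst_assoc, hW.isoPullback_hom_fst_assoc]
    have e₁ := A.gluingAt_map_left_fst h' (preimV m ⟨v, c⟩)
    have e₂ := A.toCoveringGlueApp_hom_left_fst ⟨b, c'⟩ ⟨v, c⟩ h' Y
    have e₃ := A.toCoveringGlueApp_hom_left_fst ⟨b, c'⟩ ⟨v, c⟩ h' X
    have e₄ := congrArg (fun z => z.left ≫ pullback.fst _ _) (glue_compat m ⟨b, c'⟩ ⟨v, c⟩ h')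
    simp only [Over.comp_left, Category.assoc] at e₄
    have e₅ := ι_liftE m (𝒢.graph.edgeOf b) c'
    erw [← reassoc_of% e₁, ← e₂, e₄, ← reassoc_of% e₃, e₅]
    rfl
  · -- the piece is empty
    obtain ⟨hI⟩ := A.isInitial_summand h c c' hσ ((A.toCoveringV ⟨v, c⟩).obj X)
    exact hI.hom_ext _ _

/-! ### The preimage and fullness -/

/-- The morphism `X → Y` over `A` assembled from `m : toCovering X → toCovering Y`.
[cite: MochizukiSemiAnbd2006, Def. 2.2(i) p.23] -/
noncomputable def liftHom : X ⟶ Y :=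
  Over.homMk ⟨liftV m, liftE m, comm_lift m⟩ (by
    apply BObj.hom_ext
    · funext v
      exact liftV_over m v
    · funext e
      exact liftE_over m e)

/-- The vertex pieces of `liftHom m` are the components of `m`. [cite: MochizukiSemiAnbd2006, Def. 2.2(i) p.23] -/
theorem toCoveringV_map_liftHom (vc : A.fibreData.total.Vertex) : (A.toCoveringV vc).map (liftHom m) = preimV m vc := by
  obtain ⟨v, c⟩ := vc
  ext
  apply pullback.hom_ext
  · rw [toCoveringV_map_left_fst]
    exact ι_liftV m v c
  · rw [toCoveringV_map_left_snd]
    exact (Over.w (preimV m ⟨v, c⟩)).symm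

/-- The edge pieces of `liftHom m` are the components of `m`. [cite: MochizukiSemiAnbd2006, Def. 2.2(i) p.23] -/
theorem toCoveringE_map_liftHom (ec : A.fibreData.total.Edge) : (A.toCoveringE ec).map (liftHom m) = preimE m ec := by
  obtain ⟨e, c⟩ := ec
  ext
  apply pullback.hom_ext
  · rw [toCoveringE_map_left_fst]
    exact ι_liftE m e c
  · rw [toCoveringE_map_left_snd]
    exact (Over.w (preimE m ⟨e, c⟩)).symm

/-- `toCovering A` maps `liftHom m` to `m`. [cite: MochizukiSemiAnbd2006, Def. 2.2(i) p.23] -/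
theorem toCovering_map_liftHom : A.toCovering.map (liftHom m) = m := by
  apply BObj.hom_ext
  · funext vc
    change (A.toV vc).map ((A.toCoveringV vc).map (liftHom m)) = m.fS vc
    rw [toCoveringV_map_liftHom]
    exact map_preimV m vc
  · funext ec
    change (A.toE ec).map ((A.toCoveringE ec).map (liftHom m)) = m.fT ec
    rw [toCoveringE_map_liftHom]
    exact map_preimE m ec

variable (A) in
/-- **`toCovering A : B(𝒢)_{/A} ⥤ B(𝒢_A)` is full.** [cite: MochizukiSemiAnbd2006, Def. 2.2(i) p.23] -/
theorem toCovering_full : (A.toCovering).Full :=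
  ⟨fun m => ⟨liftHom m, toCovering_map_liftHom m⟩⟩

end BObj

end SemiGraphOfAnabelioids

end Literature.AnabelianGeometry.SemiGraphs
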